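import Literature.NumberTheory.GaloisRepresentations.UnramifiedDatum
import Literature.NumberTheory.GaloisRepresentations.FramedRepBaseChange
import HarnessLib

/-!
# The non-truncation clause "the cyclotomic character is de Rham of Hodge–Tate weight `-1`"
# for `p`-adic Hodge data, and its failure for the truncated datum `K̂_nr`

Topic `Literature/NumberTheory/GaloisRepresentations`; companion of the accepted
`PstWeilDeligne`, `CrystallineDeformationRing(Smooth)` and `UnramifiedDatum`.

## Mathematics

For Fontaine's genuine de Rham period ring `B_dR(K)` of a `p`-adic field `K`, the `p`-adic
cyclotomic character `χ : Γ_K → ℤ_p^×` is de Rham (indeed crystalline):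
`D_dR(χ) = (B_dR ⊗ χ)^{Γ_K} = K · t⁻¹ ⊗ e`, a line on which the Hodge filtration jumps in degree
`-1` (`t⁻¹ ∈ Fil⁻¹ B_dR ∖ Fil⁰ B_dR`, as `σ t = χ(σ) t`); so `χ` has the single Hodge–Tate weight
`-1` in the convention of the accepted `PeriodRingData.hodgeTateWeights` ("with `B = B_dR` the
cyclotomic character has Hodge–Tate weight `-1`", Buzzard–Gee) — Fontaine 1994, Exposé III,
§1.5.4–1.5.5 and Exposé II, §1.5.5 (the element `t`, `Fil^i B_dR = t^i B_dR^+`); Tate 1967, §3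
(`ℂ_p(1)^{Γ_K} = 0`, the Hodge–Tate decomposition of `ℚ_p(1)`).

The accepted structure `PstWeilDeligneData K p` axiomatises a period-ring datum only through
properties that are blind to Tate twists, and the accepted `unramifiedPstWeilDeligneData K p`
(period ring the completed maximal unramified extension `K̂_nr = B_dR^{I_K}` with the trivial
filtration) is a model of it for which "de Rham" means "unramified" and every Hodge–Tate weight
is `0` (`unramifiedPstWeilDeligneData_isDeRhamWithWeightsIn_iff`). Consequently named facts of
the shape `∃ 𝔇 : PstWeilDeligneData K p, 𝔇.algebra = alg ∧ P 𝔇` pin the genuine datum only if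
`P` contains a clause that such truncated data violate (review of `UnramifiedDatum`, p61421:
"strengthen `nonempty` with a non-truncation clause (e.g. the cyclotomic character is de Rham
for `𝔇`) or retire it"). This file provides that clause as a predicate on the datum, in the
style of the accepted non-degeneracy predicate `PstWeilDeligneData.UnramifiedWeightsZero`, and
PROVES that the truncated datum violates it.

## What this file provides (no `sorry`, no named fact)

* `FramedGaloisRep.cyclotomicPadicAlgCl K p : FramedRep Γ_K ℚ̄_p 1` — the cyclotomic character as
  a rank-one framed representation over `ℚ̄_p` (base change of the accepted
  `FramedGaloisRep.cyclotomic K p : Γ_K →ₜ* GL_1(ℤ_p)` along `ℤ_p → ℚ_p → ℚ̄_p`), with its entry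
  formula `FramedGaloisRep.cyclotomicPadicAlgCl_apply_coe`.
* `PstWeilDeligneData.CyclotomicWeightNegOne 𝔇` — **the non-truncation clause**: the rank-one
  cyclotomic representation is `𝔇`-de Rham with all Hodge–Tate weights in `[-1, -1]`
  (accepted `PstWeilDeligneData.IsDeRhamWithWeightsIn`).
* PROVED `unramifiedPstWeilDeligneData_not_isDeRhamWithWeightsIn_of_lt`: for the truncated
  datum no representation of positive rank is de Rham with weights in an interval `[a, b]`
  missing `0`; hence PROVED `not_cyclotomicWeightNegOne_unramifiedPstWeilDeligneData`:
  **the truncated datum `unramifiedPstWeilDeligneData K p` violates the clause** — so an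
  existence fact strengthened by `CyclotomicWeightNegOne` is no longer discharged by it.

## References

* J.-M. Fontaine, *Le corps des périodes `p`-adiques* (Exposé II, §1.5) and *Représentations
  `p`-adiques semi-stables* (Exposé III, §1.5), Astérisque 223 (1994). [FontaineAsterisque223III]
* J. Tate, *`p`-divisible groups*, Proc. Conf. Local Fields (Driebergen, 1966), Springer 1967,
  §3 Thm. 2 and §4 Cor. 2 (Hodge–Tate decomposition; `ℂ_p(1)^{Γ_K} = 0`). [Tate1967pDivisible]
* K. Buzzard, T. Gee, *The conjectural connections between automorphic representations and
  Galois representations* (2014), §2.2 (sign convention: the cyclotomic character has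
  Hodge–Tate weight `-1`). [BuzzardGee2014]
-/

noncomputable section

open scoped MatrixGroups
open Field

namespace Literature.NumberTheory.GaloisRepresentations

/-! ### The cyclotomic character as a rank-one framed representation over `ℚ̄_p` -/

section Cyclotomic

variable (K : Type) [Field K] (p : ℕ) [Fact p.Prime]

/-- The ring homomorphism `ℤ_p → ℚ_p → ℚ̄_p`. [folklore] -/
def padicIntToPadicAlgCl : ℤ_[p] →+* PadicAlgCl p :=
  (algebraMap ℚ_[p] (PadicAlgCl p)).comp PadicInt.Coe.ringHom

/-- Unfolding lemma for `padicIntToPadicAlgCl`. [folklore] -/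
@[simp] lemma padicIntToPadicAlgCl_apply (x : ℤ_[p]) :
    padicIntToPadicAlgCl p x = algebraMap ℚ_[p] (PadicAlgCl p) (x : ℚ_[p]) := rfl

/-- `ℤ_p → ℚ̄_p` is continuous. [folklore] -/
lemma continuous_padicIntToPadicAlgCl : Continuous (padicIntToPadicAlgCl p) :=
  (continuous_algebraMap_padicAlgCl p).comp (continuous_subtype_val : Continuous ((↑) : ℤ_[p] → ℚ_[p]))

/-- **The `p`-adic cyclotomic character as a rank-one framed representation
`Γ_K →ₜ* GL_1(ℚ̄_p)`**: the base change of the accepted `FramedGaloisRep.cyclotomic K p`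
(`Γ_K →ₜ* GL_1(ℤ_p)`) along `ℤ_p → ℚ_p → ℚ̄_p`.
Ref: Serre, *Abelian ℓ-adic representations* (1968), Ch. I §1.2. [folklore] -/
def FramedGaloisRep.cyclotomicPadicAlgCl : FramedRep (absoluteGaloisGroup K) (PadicAlgCl p) 1 :=
  FramedRep.baseChange (padicIntToPadicAlgCl p) (continuous_padicIntToPadicAlgCl p)
    (FramedGaloisRep.cyclotomic K p)

/-- The entry of `cyclotomicPadicAlgCl K p σ` is `χ_p(σ)` (through `ℤ_p → ℚ_p → ℚ̄_p`). [folklore] -/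
@[simp] lemma FramedGaloisRep.cyclotomicPadicAlgCl_apply_coe (σ : absoluteGaloisGroup K)
    (i j : Fin 1) :
    ((FramedGaloisRep.cyclotomicPadicAlgCl K p σ : GL (Fin 1) (PadicAlgCl p)) :
        Matrix (Fin 1) (Fin 1) (PadicAlgCl p)) i j =
      algebraMap ℚ_[p] (PadicAlgCl p)
        (((GaloisRep.cyclotomicCharacter K p σ : ℤ_[p]ˣ) : ℤ_[p]) : ℚ_[p]) := by
  simp [FramedGaloisRep.cyclotomicPadicAlgCl, FramedGaloisRep.cyclotomic]

end Cyclotomic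

/-! ### The non-truncation clause -/

section Pst

variable {K : Type} [Field K] [ValuativeRel K] [TopologicalSpace K] [IsNonarchimedeanLocalField K]
  {p : ℕ} [Fact p.Prime]

namespace PstWeilDeligneData

/-- **Non-truncation clause for a `p`-adic Hodge datum: the cyclotomic character is de Rham of
Hodge–Tate weight `-1`.** For the datum `𝔇` (intended: Fontaine's `B_dR(K)`), the rank-one
cyclotomic representation `Γ_K →ₜ* GL_1(ℚ̄_p)` is `𝔇`-de Rham with all its Hodge–Tate weights
in `[-1, -1]` (accepted `IsDeRhamWithWeightsIn`; weights in the convention of the accepted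
`PeriodRingData.hodgeTateWeights`, for which the cyclotomic character has weight `-1`). TRUE for
the genuine datum: `D_dR(χ) = K · t⁻¹ ⊗ e` with `t⁻¹ ∈ Fil⁻¹ ∖ Fil⁰` (Fontaine 1994, Exposé III
§1.5; Tate 1967 §3). A predicate on the datum, in the style of the accepted non-degeneracy
predicate `UnramifiedWeightsZero`; it is violated by the truncated datum
`unramifiedPstWeilDeligneData K p` (`not_cyclotomicWeightNegOne_unramifiedPstWeilDeligneData`),
so that existence facts `∃ 𝔇, 𝔇.algebra = alg ∧ 𝔇.CyclotomicWeightNegOne ∧ …` are not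
discharged by inertia-invariant truncations of `B_dR`.
[cite: FontaineAsterisque223III, Exp. III §1.5] [cite: BuzzardGee2014, §2.2] -/
def CyclotomicWeightNegOne (𝔇 : PstWeilDeligneData K p) : Prop :=
  𝔇.IsDeRhamWithWeightsIn (-1) (-1) (FramedGaloisRep.cyclotomicPadicAlgCl K p)

/-- Unfolding lemma for `CyclotomicWeightNegOne`. [folklore] -/
lemma cyclotomicWeightNegOne_iff (𝔇 : PstWeilDeligneData K p) :
    𝔇.CyclotomicWeightNegOne ↔
      𝔇.IsDeRhamWithWeightsIn (-1) (-1) (FramedGaloisRep.cyclotomicPadicAlgCl K p) :=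
  Iff.rfl

/-- Under the clause the cyclotomic character is in particular `𝔇`-de Rham. [folklore] -/
lemma CyclotomicWeightNegOne.isDeRhamFramed {𝔇 : PstWeilDeligneData K p}
    (h : 𝔇.CyclotomicWeightNegOne) :
    𝔇.IsDeRhamFramed (FramedGaloisRep.cyclotomicPadicAlgCl K p) := by
  letI := 𝔇.algebra
  obtain ⟨E, hE, rE, hmodel, hdR, -⟩ := h
  exact ⟨E, hE, rE, hmodel, hdR⟩

end PstWeilDeligneData

/-! ### The truncated datum violates the clause -/

/-- For the truncated datum `K̂_nr` (trivial filtration), no representation of positive rank is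
de Rham with Hodge–Tate weights in an interval `[a, b]` with `b < 0`: all its weights are `0`
(`unramifiedPstWeilDeligneData_isDeRhamWithWeightsIn_iff`). [folklore] -/
theorem unramifiedPstWeilDeligneData_not_isDeRhamWithWeightsIn_of_lt [Algebra ℚ_[p] K] {n : ℕ}
    (hn : n ≠ 0) {a b : ℤ} (hb : b < 0)
    (ρ : FramedRep (absoluteGaloisGroup K) (PadicAlgCl p) n) :
    ¬ (unramifiedPstWeilDeligneData K p).IsDeRhamWithWeightsIn a b ρ := by
  rw [unramifiedPstWeilDeligneData_isDeRhamWithWeightsIn_iff]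
  rintro ⟨-, h | ⟨-, h⟩⟩
  · exact hn h
  · exact absurd h (not_le.mpr hb)

/-- Likewise for an interval `[a, b]` with `0 < a`. [folklore] -/
theorem unramifiedPstWeilDeligneData_not_isDeRhamWithWeightsIn_of_pos [Algebra ℚ_[p] K] {n : ℕ}
    (hn : n ≠ 0) {a b : ℤ} (ha : 0 < a)
    (ρ : FramedRep (absoluteGaloisGroup K) (PadicAlgCl p) n) :
    ¬ (unramifiedPstWeilDeligneData K p).IsDeRhamWithWeightsIn a b ρ := by
  rw [unramifiedPstWeilDeligneData_isDeRhamWithWeightsIn_iff]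
  rintro ⟨-, h | ⟨h, -⟩⟩
  · exact hn h
  · exact absurd h (not_le.mpr ha)

/-- **The truncated datum violates the non-truncation clause**: for
`𝔇 = unramifiedPstWeilDeligneData K p` (period ring `K̂_nr`, trivial filtration) the cyclotomic
character is not de Rham of weight `-1` (it is not even `𝔇`-de Rham, being ramified; the proof
only uses that all `𝔇`-weights are `0`). Hence an existence fact over `PstWeilDeligneData K p`
that includes the clause `CyclotomicWeightNegOne` cannot be discharged by this datum. [folklore] -/
theorem not_cyclotomicWeightNegOne_unramifiedPstWeilDeligneData [Algebra ℚ_[p] K] :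
    ¬ (unramifiedPstWeilDeligneData K p).CyclotomicWeightNegOne :=
  unramifiedPstWeilDeligneData_not_isDeRhamWithWeightsIn_of_lt one_ne_zero (by norm_num) _

/-- Reformulation: no datum with the clause has the truncated datum's notion of
"de Rham with weights": if `𝔇.CyclotomicWeightNegOne` then `𝔇 ≠ unramifiedPstWeilDeligneData K p`.
[folklore] -/
theorem PstWeilDeligneData.CyclotomicWeightNegOne.ne_unramifiedPstWeilDeligneData
    [Algebra ℚ_[p] K] {𝔇 : PstWeilDeligneData K p} (h : 𝔇.CyclotomicWeightNegOne) :
    𝔇 ≠ unramifiedPstWeilDeligneData K p := by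
  rintro rfl
  exact not_cyclotomicWeightNegOne_unramifiedPstWeilDeligneData h

end Pst

end Literature.NumberTheory.GaloisRepresentations

end
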